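import Summits.KontsevichZagierPeriods.Zeta5Search.Barrier.ConeGammaEnvelopeCheck
import Summits.KontsevichZagierPeriods.Zeta5Search.Barrier.ConeGammaLemmaFWinBoxCert

/-!
# ζ(5) search — BARRIER: THE ENVELOPE BOUND WITHOUT CALCULUS — soundness of the first-order checker

HONEST FRAMING (cell `pub-zeta5`): systematic search; no irrationality claim unless kernel-certified. Theorems only. MODEL
objects under Brown–Zudilin's (28)+(30) ((28) observed, not proved): BZ's growth functional `growthLogR` at critical points
(`ConeGammaRates.IsCritical`), cert-2 g39's value function `Envelope.valueV` and checker `Envelope.envSummary /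
envBoxCheck`. Nothing here is a statement about the size of any critical value of record, any γ, the cone's supremum
(C2 OPEN), S-E (CONJECTURED), (TD_A) or `ζ(5)`; no number of record moves; records in print UNMOVED. Theory seat cert-2 g39
(item «THE ENVELOPE BOUND FOR C₁ WITHOUT CALCULUS», part 3a).

* `formVal_range` — the exact range of a form on box × tube; `formLogI_sound` — one strict sign, modulus range `[m, M]`,
  every number between `log m` and `log M` lies in `I`, and `(log M − log m)·SC ≤ I.hi − I.lo`;
  `form_secant` / `form_tangent` — the SECANT representation with slope in `I` between any two points of box × tube and the
  TANGENT-DIFFERENCE bound;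
* `envAcc_sound` — over a list of forms: (H) the hull invariant «∀ (X,Y) in the tube ∀ t ∈ box ∃ v ∈ g,
  valF t X Y − valF c X Y = Σ (t_i − c_i)·v_i», (E) the tangent-difference budget at the centre:
  `|valF c X Y − valF c X′ Y′ − (ΔX·gxF + ΔY·gyF)(c, X′, Y′)| ≤ e/(SC·Q)`, (N) no form vanishes on box × tube;
The first-order theorem itself is `ConeGammaEnvelopeFirstOrder.critical_value_first_order`.
-/

noncomputable section

open Finset Set
open Literature.Analysis.ValidatedNumerics.NumericsMP

namespace Summit.KontsevichZagierPeriods.Zeta5Search.Barrier.ConeGamma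

namespace Envelope

open LemmaFBox (SC SC_pos KT coef featVal minNum maxNum sum8 lnNat box centre centre_mem abs_sub_centre_le abs_le_of_mem
  minNum_le le_maxNum cast_toNat_of_pos getD_map_range featVal_sub_eq_sum sum8_eq_sum mem_log_of_range)
open LemmaFWinBox (getI addHull zeroHull hull_zero hull_addHull getI_addHull boxOK8 boxOK8_spec)
open LemmaFWin (zI mem_zI)

/-! ### One form on box × tube -/

/-- The tube at scale `Q = 2·D·T₀` as a set of points `(X, Y)`: `xlo ≤ Q·X ≤ xhi`, `ylo ≤ Q·Y ≤ yhi`. -/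
def tube (D T0 : ℕ) (tb : Tube) : Set (ℝ × ℝ) :=
  {P | ((tb.xlo : ℝ) ≤ P.1 * (2 * D * T0) ∧ P.1 * (2 * D * T0) ≤ (tb.xhi : ℝ)) ∧
    ((tb.ylo : ℝ) ≤ P.2 * (2 * D * T0) ∧ P.2 * (2 * D * T0) ≤ (tb.yhi : ℝ))}

/-- `min (b·l) (b·h) ≤ b·x ≤ max (b·l) (b·h)` for `l ≤ x ≤ h` (either sign of `b`). -/
theorem mul_mem_minmax (b : ℤ) {l h x : ℝ} (hl : l ≤ x) (hh : x ≤ h) :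
    min ((b : ℝ) * l) ((b : ℝ) * h) ≤ (b : ℝ) * x ∧ (b : ℝ) * x ≤ max ((b : ℝ) * l) ((b : ℝ) * h) := by
  rcases le_or_gt 0 (b : ℝ) with hb | hb
  · exact ⟨(min_le_left _ _).trans (mul_le_mul_of_nonneg_left hl hb),
      (mul_le_mul_of_nonneg_left hh hb).trans (le_max_right _ _)⟩
  · exact ⟨(min_le_right _ _).trans (mul_le_mul_of_nonpos_left hh hb.le),
      (mul_le_mul_of_nonpos_left hl hb.le).trans (le_max_left _ _)⟩

/-- **The exact range of a form** on box × tube: `rangeLo ≤ Q·L ≤ rangeHi`, `Q = 2·D·T₀`. -/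
theorem formVal_range {D T0 : ℕ} {lo hi : List ℕ} {tb : Tube} (f : EForm) {t : Fin 8 → ℝ} (ht : t ∈ box D lo hi)
    {X Y : ℝ} (hXY : (X, Y) ∈ tube D T0 tb) :
    (rangeLo T0 lo hi tb f : ℝ) ≤ formVal f t X Y * (2 * D * T0) ∧
      formVal f t X Y * (2 * D * T0) ≤ (rangeHi T0 lo hi tb f : ℝ) := by
  simp only [tube, Set.mem_setOf_eq] at hXY
  obtain ⟨hX, hY⟩ := hXY
  have h1 := minNum_le ht f.al
  have h2 := le_maxNum ht f.al
  have hx := mul_mem_minmax f.bx hX.1 hX.2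
  have hy := mul_mem_minmax f.bY hY.1 hY.2
  have hT : (0 : ℝ) ≤ 2 * T0 := by positivity
  have e : formVal f t X Y * (2 * D * T0) = 2 * T0 * (featVal f.al t * D) + (f.bx : ℝ) * (X * (2 * D * T0))
      + (f.bY : ℝ) * (Y * (2 * D * T0)) := by unfold formVal; ring
  unfold rangeLo rangeHi
  push_cast
  rw [e]
  constructor
  · nlinarith [mul_le_mul_of_nonneg_left h1 hT, hx.1, hy.1]
  · nlinarith [mul_le_mul_of_nonneg_left h2 hT, hx.2, hy.2]

/-- **Soundness of the per-form log interval.** If `formLogI … f = some I` then there are reals `0 < m ≤ M` such that every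
number between `log m` and `log M` lies in `I`, `(log M − log m)·SC ≤ I.hi − I.lo`, and at EVERY point of box × tube the
form has modulus in `[m, M]` with one fixed strict sign. -/
theorem formLogI_sound {D T0 : ℕ} (hD : 0 < D) (hT0 : 0 < T0) {lo hi : List ℕ} {tb : Tube} {f : EForm} {I : MI}
    (h : formLogI D T0 lo hi tb f = some I) :
    ∃ m M : ℝ, 0 < m ∧ m ≤ M ∧ (∀ θ : ℝ, Real.log m ≤ θ → θ ≤ Real.log M → MI.mem SC θ I) ∧
      (Real.log M - Real.log m) * SC ≤ (I.hi : ℝ) - I.lo ∧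
      ((∀ ⦃t : Fin 8 → ℝ⦄, t ∈ box D lo hi → ∀ ⦃X Y : ℝ⦄, (X, Y) ∈ tube D T0 tb → m ≤ formVal f t X Y ∧ formVal f t X Y ≤ M) ∨
       (∀ ⦃t : Fin 8 → ℝ⦄, t ∈ box D lo hi → ∀ ⦃X Y : ℝ⦄, (X, Y) ∈ tube D T0 tb → m ≤ -formVal f t X Y ∧ -formVal f t X Y ≤ M)) := by
  unfold formLogI at h
  set mM := modRange T0 lo hi tb f with hmM
  by_cases hbad : mM.1 ≤ 0 ∨ mM.2 < mM.1
  · rw [if_pos hbad] at h; simp at h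
  rw [if_neg hbad] at h
  rw [not_or, not_le, not_lt] at hbad
  obtain ⟨hm1, hm12⟩ := hbad
  split at h
  swap
  · simp at h
  rename_i Lm LM LQ hLm hLM hLQ
  simp only [Option.some.injEq] at h
  subst h
  have hQ : (0 : ℝ) < 2 * D * T0 := by positivity
  have hQn : 0 < 2 * D * T0 := by positivity
  have hS : (0 : ℝ) < SC := by exact_mod_cast SC_pos
  have hm2 : 0 < mM.2 := lt_of_lt_of_le hm1 hm12
  set m : ℝ := (mM.1 : ℝ) / (2 * D * T0) with hmdef
  set M : ℝ := (mM.2 : ℝ) / (2 * D * T0) with hMdef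
  have hm0 : 0 < m := by rw [hmdef]; exact div_pos (by exact_mod_cast hm1) hQ
  have hmle : m ≤ M := by
    rw [hmdef, hMdef]; exact div_le_div_of_nonneg_right (by exact_mod_cast hm12) hQ.le
  have hQc : ((2 * D * T0 : ℕ) : ℝ) = 2 * D * T0 := by push_cast; ring
  have hlm : MI.mem SC (Real.log m) (Lm.sub LQ) := by
    have := mem_log_of_range (D := 2 * D * T0) (x := m) hQn hm1 (MI.mem_logNat2 SC_pos hLm)
      (MI.mem_logNat2 SC_pos hLm) (MI.mem_logNat2 SC_pos hLQ)
      (by rw [hQc, hmdef, div_mul_cancel₀ _ hQ.ne']) (by rw [hQc, hmdef, div_mul_cancel₀ _ hQ.ne'])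
    exact this
  have hlM : MI.mem SC (Real.log M) (LM.sub LQ) := by
    have := mem_log_of_range (D := 2 * D * T0) (x := M) hQn hm2 (MI.mem_logNat2 SC_pos hLM)
      (MI.mem_logNat2 SC_pos hLM) (MI.mem_logNat2 SC_pos hLQ)
      (by rw [hQc, hMdef, div_mul_cancel₀ _ hQ.ne']) (by rw [hQc, hMdef, div_mul_cancel₀ _ hQ.ne'])
    exact this
  have espan : MI.span (Lm.sub LQ) (LM.sub LQ) = (MI.span Lm LM).sub LQ := rfl
  refine ⟨m, M, hm0, hmle, ?_, ?_, ?_⟩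
  · intro θ h1 h2
    rw [← espan]
    exact MI.mem_span hlm hlM h1 h2
  · have a1 := hlm.1; have a2 := hlM.2
    simp only [MI.sub, MI.span] at a1 a2 ⊢
    push_cast at a1 a2 ⊢
    have hLQ' := (MI.mem_logNat2 SC_pos hLQ)
    have q1 := hLQ'.1; have q2 := hLQ'.2
    nlinarith
  · -- sign cases
    have hpt : ∀ ⦃t : Fin 8 → ℝ⦄, t ∈ box D lo hi → ∀ ⦃X Y : ℝ⦄, (X, Y) ∈ tube D T0 tb →
        (rangeLo T0 lo hi tb f : ℝ) ≤ formVal f t X Y * (2 * D * T0) ∧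
          formVal f t X Y * (2 * D * T0) ≤ (rangeHi T0 lo hi tb f : ℝ) :=
      fun t ht X Y hXY => formVal_range f ht hXY
    by_cases h1 : 0 < rangeLo T0 lo hi tb f
    · have e : mM = (rangeLo T0 lo hi tb f, rangeHi T0 lo hi tb f) := by rw [hmM]; simp [modRange, h1]
      left
      intro t ht X Y hXY
      obtain ⟨r1, r2⟩ := hpt ht hXY
      rw [hmdef, hMdef, e]
      constructor
      · rw [div_le_iff₀ hQ]; exact r1
      · rw [le_div_iff₀ hQ]; exact r2
    · by_cases h2 : rangeHi T0 lo hi tb f < 0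
      · have e : mM = (-rangeHi T0 lo hi tb f, -rangeLo T0 lo hi tb f) := by rw [hmM]; simp [modRange, h1, h2]
        right
        intro t ht X Y hXY
        obtain ⟨r1, r2⟩ := hpt ht hXY
        rw [hmdef, hMdef, e]
        push_cast
        constructor
        · rw [div_le_iff₀ hQ]; linarith
        · rw [le_div_iff₀ hQ]; linarith
      · exfalso
        have : mM = (0, 0) := by rw [hmM]; simp [modRange, h1, h2]
        rw [this] at hm1; simp at hm1

/-- **Secant representation for one form** between two points of box × tube: slope in `I`. -/
theorem form_secant {D T0 : ℕ} (hD : 0 < D) (hT0 : 0 < T0) {lo hi : List ℕ} {tb : Tube} {f : EForm} {I : MI}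
    (h : formLogI D T0 lo hi tb f = some I) {t t' : Fin 8 → ℝ} (ht : t ∈ box D lo hi) (ht' : t' ∈ box D lo hi)
    {X Y X' Y' : ℝ} (hP : (X, Y) ∈ tube D T0 tb) (hP' : (X', Y') ∈ tube D T0 tb) :
    ∃ θ : ℝ, MI.mem SC θ I ∧
      xlnx (formVal f t X Y) - xlnx (formVal f t' X' Y') = θ * (formVal f t X Y - formVal f t' X' Y') := by
  obtain ⟨m, M, hm, _, hmem, _, hsgn⟩ := formLogI_sound hD hT0 h
  have hsign : (m ≤ formVal f t' X' Y' ∧ formVal f t' X' Y' ≤ M ∧ m ≤ formVal f t X Y ∧ formVal f t X Y ≤ M) ∨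
      (m ≤ -formVal f t' X' Y' ∧ -formVal f t' X' Y' ≤ M ∧ m ≤ -formVal f t X Y ∧ -formVal f t X Y ≤ M) := by
    rcases hsgn with hp | hn
    · exact Or.inl ⟨(hp ht' hP').1, (hp ht' hP').2, (hp ht hP).1, (hp ht hP).2⟩
    · exact Or.inr ⟨(hn ht' hP').1, (hn ht' hP').2, (hn ht hP).1, (hn ht hP).2⟩
  obtain ⟨θ, h1, h2, e⟩ := xlnx_secant hm hsign
  exact ⟨θ, hmem θ h1 h2, e⟩

/-- **Tangent-difference bound for one form** between two points of box × tube: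
`|xlnx L − xlnx L′ − (L − L′)·log|L′|| ≤ ((I.hi − I.lo)/SC)·|L − L′|`. -/
theorem form_tangent {D T0 : ℕ} (hD : 0 < D) (hT0 : 0 < T0) {lo hi : List ℕ} {tb : Tube} {f : EForm} {I : MI}
    (h : formLogI D T0 lo hi tb f = some I) {t t' : Fin 8 → ℝ} (ht : t ∈ box D lo hi) (ht' : t' ∈ box D lo hi)
    {X Y X' Y' : ℝ} (hP : (X, Y) ∈ tube D T0 tb) (hP' : (X', Y') ∈ tube D T0 tb) :
    |xlnx (formVal f t X Y) - xlnx (formVal f t' X' Y')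
        - (formVal f t X Y - formVal f t' X' Y') * Real.log (|formVal f t' X' Y'|)|
      ≤ (((I.hi : ℝ) - I.lo) / SC) * |formVal f t X Y - formVal f t' X' Y'| := by
  obtain ⟨m, M, hm, _, _, hw, hsgn⟩ := formLogI_sound hD hT0 h
  have hS : (0 : ℝ) < SC := by exact_mod_cast SC_pos
  have hsign : (m ≤ formVal f t' X' Y' ∧ formVal f t' X' Y' ≤ M ∧ m ≤ formVal f t X Y ∧ formVal f t X Y ≤ M) ∨
      (m ≤ -formVal f t' X' Y' ∧ -formVal f t' X' Y' ≤ M ∧ m ≤ -formVal f t X Y ∧ -formVal f t X Y ≤ M) := by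
    rcases hsgn with hp | hn
    · exact Or.inl ⟨(hp ht' hP').1, (hp ht' hP').2, (hp ht hP).1, (hp ht hP).2⟩
    · exact Or.inr ⟨(hn ht' hP').1, (hn ht' hP').2, (hn ht hP).1, (hn ht hP).2⟩
  refine (xlnx_tangent_diff hm hsign).trans (mul_le_mul_of_nonneg_right ?_ (abs_nonneg _))
  rw [le_div_iff₀ hS]; exact hw

/-- **No form vanishes** on box × tube. -/
theorem form_ne_zero {D T0 : ℕ} (hD : 0 < D) (hT0 : 0 < T0) {lo hi : List ℕ} {tb : Tube} {f : EForm} {I : MI}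
    (h : formLogI D T0 lo hi tb f = some I) {t : Fin 8 → ℝ} (ht : t ∈ box D lo hi) {X Y : ℝ}
    (hP : (X, Y) ∈ tube D T0 tb) : formVal f t X Y ≠ 0 := by
  obtain ⟨m, M, hm, _, _, _, hsgn⟩ := formLogI_sound hD hT0 h
  rcases hsgn with hp | hn
  · have := (hp ht hP).1; intro h0; rw [h0] at this; linarith
  · have := (hn ht hP).1; intro h0; rw [h0] at this; linarith

/-- The box centre lies in the degenerate box `centrePt ≤ 2D·t ≤ centrePt` (scale `2D`). -/
theorem centre_mem_cbox {D : ℕ} (hD : 0 < D) (lo hi : List ℕ) :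
    centre D lo hi ∈ box (2 * D) (LemmaFWinBox.centrePt lo hi) (LemmaFWinBox.centrePt lo hi) := by
  intro i
  have e := LemmaFWinBox.centre_mul D hD lo hi i
  push_cast at e ⊢
  rw [e]
  exact ⟨le_rfl, le_rfl⟩

/-! ### The list recursion -/

/-- The `t`-difference of a form at fixed `(X, Y)` is the feature difference. -/
theorem formVal_sub_t (f : EForm) (t t' : Fin 8 → ℝ) (X Y : ℝ) :
    formVal f t X Y - formVal f t' X Y = featVal f.al t - featVal f.al t' := by
  unfold formVal; ring

/-- The `(X,Y)`-difference of a form at fixed `t`. -/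
theorem formVal_sub_w (f : EForm) (t : Fin 8 → ℝ) (X Y X' Y' : ℝ) :
    formVal f t X Y - formVal f t X' Y' = (f.bx : ℝ) * (X - X') + (f.bY : ℝ) * (Y - Y') := by
  unfold formVal; ring

/-- Distance inside the tube: `|X − X′|·Q ≤ xhi − xlo`, `|Y − Y′|·Q ≤ yhi − ylo`. -/
theorem tube_dist {D T0 : ℕ} {tb : Tube} {X Y X' Y' : ℝ} (hP : (X, Y) ∈ tube D T0 tb) (hP' : (X', Y') ∈ tube D T0 tb) :
    |X - X'| * (2 * D * T0) ≤ (tb.xhi : ℝ) - tb.xlo ∧ |Y - Y'| * (2 * D * T0) ≤ (tb.yhi : ℝ) - tb.ylo := by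
  simp only [tube, Set.mem_setOf_eq] at hP hP'
  obtain ⟨⟨a1, a2⟩, ⟨b1, b2⟩⟩ := hP
  obtain ⟨⟨c1, c2⟩, ⟨d1, d2⟩⟩ := hP'
  have hQ : (0 : ℝ) ≤ 2 * D * T0 := by positivity
  constructor
  · rw [← abs_of_nonneg hQ, ← abs_mul, abs_le]; constructor <;> nlinarith
  · rw [← abs_of_nonneg hQ, ← abs_mul, abs_le]; constructor <;> nlinarith

/-- **Soundness of the accumulator** over any list of forms: (H) hull invariant at every fixed `(X, Y)` of the tube,
(E) tangent-difference budget at the centre, (N) no form vanishes. -/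
theorem envAcc_sound {D T0 : ℕ} (hD : 0 < D) (hT0 : 0 < T0 / 2) (hT2 : T0 % 2 = 0) {lo hi : List ℕ}
    (hle : ∀ i : Fin 8, lo.getD i 0 ≤ hi.getD i 0) {tb : Tube} {dX dY : ℕ} :
    ∀ (F : List EForm) {g : List MI} {e : ℤ}, envAcc D T0 lo hi tb dX dY F = some (g, e) →
      (∀ ⦃X Y : ℝ⦄, (X, Y) ∈ tube D T0 tb → ∀ t ∈ box D lo hi, ∃ v : Fin 8 → ℝ, (∀ i : Fin 8, MI.mem SC (v i) (getI g i)) ∧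
        valF F t X Y - valF F (centre D lo hi) X Y = ∑ i : Fin 8, (t i - centre D lo hi i) * v i) ∧
      (∀ ⦃X Y X' Y' : ℝ⦄, (X, Y) ∈ tube D T0 tb → (X', Y') ∈ tube D T0 tb →
        |X - X'| * (2 * D * T0) ≤ dX → |Y - Y'| * (2 * D * T0) ≤ dY →
        |valF F (centre D lo hi) X Y - valF F (centre D lo hi) X' Y'
          - ((X - X') * gxF F (centre D lo hi) X' Y' + (Y - Y') * gyF F (centre D lo hi) X' Y')|
          ≤ (e : ℝ) / (SC * (2 * D * T0))) ∧
      (∀ f ∈ F, ∀ ⦃t : Fin 8 → ℝ⦄, t ∈ box D lo hi → ∀ ⦃X Y : ℝ⦄, (X, Y) ∈ tube D T0 tb → formVal f t X Y ≠ 0)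
  | [], g, e, h => by
    simp only [envAcc, Option.some.injEq, Prod.mk.injEq] at h
    obtain ⟨rfl, rfl⟩ := h
    refine ⟨fun X Y _ t ht => ?_, fun X Y X' Y' _ _ _ _ => ?_, fun f hf => by simp at hf⟩
    · obtain ⟨v, hv, e⟩ := hull_zero D lo hi t ht
      exact ⟨v, hv, by simp [valF_nil] at e ⊢; exact e⟩
    · simp [valF_nil, gxF_nil, gyF_nil]
  | f :: F, g, e, h => by
    simp only [envAcc] at h
    split at h
    swap
    · simp at h
    rename_i g' e' I Ic hF hI hIc
    simp only [Option.some.injEq, Prod.mk.injEq] at h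
    obtain ⟨rfl, rfl⟩ := h
    obtain ⟨IH1, IH2, IH3⟩ := envAcc_sound hD hT0 hT2 hle F hF
    have hS : (0 : ℝ) < SC := by exact_mod_cast SC_pos
    have hT0' : 0 < T0 := by omega
    have hQ : (0 : ℝ) < 2 * D * T0 := by positivity
    have hcmem : centre D lo hi ∈ box D lo hi := centre_mem hD hle
    -- the degenerate centre box has the same scale: `2·(2D)·(T₀/2) = 2·D·T₀`
    have hT0e : 2 * (T0 / 2) = T0 := by omega
    have eQ : (2 * ((2 * D : ℕ) : ℝ) * ((T0 / 2 : ℕ) : ℝ)) = 2 * D * T0 := by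
      have : ((2 * (T0 / 2) : ℕ) : ℝ) = (T0 : ℝ) := by exact_mod_cast hT0e
      push_cast at this ⊢; nlinarith [this]
    have hcc := centre_mem_cbox hD lo hi
    have ctube : ∀ ⦃A B : ℝ⦄, (A, B) ∈ tube D T0 tb → (A, B) ∈ tube (2 * D) (T0 / 2) tb := by
      intro A B hAB
      simp only [tube, Set.mem_setOf_eq] at hAB ⊢
      rw [eQ]; exact hAB
    refine ⟨fun X Y hXY t ht => ?_, fun X Y X' Y' hP hP' hdX hdY => ?_, fun f' hf' => ?_⟩
    · -- (H): add the secant of form `f`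
      have hG : ∀ t ∈ box D lo hi, ∃ θ : ℝ, MI.mem SC θ I ∧
          xlnx (formVal f t X Y) - xlnx (formVal f (centre D lo hi) X Y)
            = θ * (featVal f.al t - featVal f.al (centre D lo hi)) := by
        intro u hu
        obtain ⟨θ, hθ, e⟩ := form_secant hD hT0' hI hu hcmem hXY hXY
        exact ⟨θ, hθ, by rw [e, formVal_sub_t]⟩
      obtain ⟨v, hv, e⟩ := hull_addHull (IH1 hXY) (k := f.sg) hG t ht
      refine ⟨v, hv, ?_⟩
      rw [valF_cons, valF_cons]
      linarith
    · -- (E): the tangent difference of form `f` (interval over {centre} × tube) plus the budget of `F`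
      have hT := form_tangent (D := 2 * D) (T0 := T0 / 2) (by positivity) hT0 hIc hcc hcc (ctube hP) (ctube hP')
      set L := formVal f (centre D lo hi) X Y with hL
      set L' := formVal f (centre D lo hi) X' Y' with hL'
      have eL : L - L' = (f.bx : ℝ) * (X - X') + (f.bY : ℝ) * (Y - Y') := by rw [hL, hL', formVal_sub_w]
      have esplit : valF (f :: F) (centre D lo hi) X Y - valF (f :: F) (centre D lo hi) X' Y'
          - ((X - X') * gxF (f :: F) (centre D lo hi) X' Y' + (Y - Y') * gyF (f :: F) (centre D lo hi) X' Y')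
          = (f.sg : ℝ) * (xlnx L - xlnx L' - (L - L') * Real.log (|L'|))
            + (valF F (centre D lo hi) X Y - valF F (centre D lo hi) X' Y'
              - ((X - X') * gxF F (centre D lo hi) X' Y' + (Y - Y') * gyF F (centre D lo hi) X' Y')) := by
        rw [valF_cons, valF_cons, gxF_cons, gyF_cons, eL]; ring
      rw [esplit]
      refine (abs_add_le _ _).trans ?_
      -- the form term
      have hw : |L - L'| * (2 * D * T0) ≤ |(f.bx : ℝ)| * (dX : ℝ) + |(f.bY : ℝ)| * (dY : ℝ) := by
        rw [eL]
        calc |(f.bx : ℝ) * (X - X') + (f.bY : ℝ) * (Y - Y')| * (2 * D * T0)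
            ≤ (|(f.bx : ℝ) * (X - X')| + |(f.bY : ℝ) * (Y - Y')|) * (2 * D * T0) :=
              mul_le_mul_of_nonneg_right (abs_add_le _ _) hQ.le
          _ = |(f.bx : ℝ)| * (|X - X'| * (2 * D * T0)) + |(f.bY : ℝ)| * (|Y - Y'| * (2 * D * T0)) := by
              rw [abs_mul, abs_mul]; ring
          _ ≤ |(f.bx : ℝ)| * (dX : ℝ) + |(f.bY : ℝ)| * (dY : ℝ) :=
              add_le_add (mul_le_mul_of_nonneg_left hdX (abs_nonneg _))
                (mul_le_mul_of_nonneg_left hdY (abs_nonneg _))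
      have hI0 : (0 : ℝ) ≤ (Ic.hi : ℝ) - Ic.lo := by
        obtain ⟨m, M, hm, hmM, _, hw', _⟩ := formLogI_sound (D := 2 * D) (T0 := T0 / 2) (by positivity) hT0 hIc
        have : 0 ≤ Real.log M - Real.log m := by linarith [Real.log_le_log hm hmM]
        nlinarith
      have hterm : |(f.sg : ℝ) * (xlnx L - xlnx L' - (L - L') * Real.log (|L'|))|
          ≤ (((Ic.hi - Ic.lo) * (f.sg.natAbs : ℤ) * ((f.bx.natAbs : ℤ) * dX + (f.bY.natAbs : ℤ) * dY) : ℤ) : ℝ)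
            / (SC * (2 * D * T0)) := by
        rw [abs_mul]
        push_cast
        have step : |(f.sg : ℝ)| * |xlnx L - xlnx L' - (L - L') * Real.log (|L'|)|
            ≤ |(f.sg : ℝ)| * ((((Ic.hi : ℝ) - Ic.lo) / SC) * |L - L'|) :=
          mul_le_mul_of_nonneg_left hT (abs_nonneg _)
        refine step.trans ?_
        rw [le_div_iff₀ (by positivity)]
        calc |(f.sg : ℝ)| * (((Ic.hi : ℝ) - Ic.lo) / SC * |L - L'|) * (SC * (2 * D * T0))
            = |(f.sg : ℝ)| * ((Ic.hi : ℝ) - Ic.lo) * (|L - L'| * (2 * D * T0)) := by field_simp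
          _ ≤ |(f.sg : ℝ)| * ((Ic.hi : ℝ) - Ic.lo) * (|(f.bx : ℝ)| * (dX : ℝ) + |(f.bY : ℝ)| * (dY : ℝ)) :=
              mul_le_mul_of_nonneg_left hw (mul_nonneg (abs_nonneg _) hI0)
          _ = _ := by ring
      have h2 := IH2 hP hP' hdX hdY
      have := add_le_add hterm h2
      refine this.trans (le_of_eq ?_)
      push_cast
      ring
    · -- (N)
      rcases List.mem_cons.mp hf' with rfl | hmem
      · exact fun t ht X Y hXY => form_ne_zero hD hT0' hI ht hXY
      · exact IH3 f' hmem

end Envelope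

end Summit.KontsevichZagierPeriods.Zeta5Search.Barrier.ConeGamma

end
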